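import Literature.RingTheory.FormalGroups.LawOfLogarithm
import Literature.RingTheory.FormalGroups.FormalOModuleBudCongr
import HarnessLib

/-!
# Perturbing a logarithm in degree `m`: how `f⁻¹(f(X) + f(Y))` and `f⁻¹(a·f(X))` move
# ([Hazewinkel 1978] §5.7, (5.7.?)–style «congruences mod (U-degree n+1)»; [Lazard 1955] §II Prop. 2)

Topic `Literature/RingTheory/FormalGroups`; namespace `Literature.RingTheory.FormalGroups`.  THEOREMS ONLY (no definition, no
named fact, no instance, no `sorry`).  Cell `hodgecm-mathlib`, P6 «MOD programme» sub-line P6d (`stub_L4B3cO`), road «universal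
formal `𝒪`-module law»: the degree bookkeeping by which the coefficient of `S_m` in Hazewinkel's universal law is read off.

Let `ψ, ψ' ∈ K⟦X⟧` be strict series (`ψ(0) = 0`, `[X]ψ = 1`) with `ψ ≡ ψ' + c X^m (mod deg m+1)`, `m ≥ 2`.

* `le_order_logLaw_sub_logLaw_add` — if `ψ(F) = ψ(X₀) + ψ(X₁)` and `ψ'(F') = ψ'(X₀) + ψ'(X₁)` (the laws with logarithms `ψ`,
  `ψ'`; `F' ≡ X₀ + X₁ (mod deg 2)`) then  **`F ≡ F' − c·B_m (mod deg m+1)`**, `B_m = (X₀+X₁)^m − X₀^m − X₁^m`.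
* `le_order_logAct_sub_logAct_sub` — if `ψ(h) = a·ψ`, `ψ'(h') = a·ψ'` (the `[a]`-series; `h' ≡ aX (mod deg 2)`) then
  **`h ≡ h' + c(a − a^m) X^m (mod deg m+1)`**.

Proofs: `ψ` is injective modulo degrees (★ `le_order_sub_of_log_subst`), and `ψ(F' − cB_m) ≡ ψ(F') − cB_m ≡ ψ'(F') + cF'^m −
cB_m ≡ ψ'(X₀) + ψ'(X₁) + c(X₀^m + X₁^m) ≡ ψ(X₀) + ψ(X₁) = ψ(F) (mod deg m+1)` by the first-order expansion of a strict series
(★ `le_order_psubst_sub_psubst_sub`, Lazard's Lemme 1); similarly for `[a]`.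

## References
* [Hazewinkel1978] M. Hazewinkel, *Formal Groups and Applications* (1978), §5.7 (how the coefficients of `f_U` enter `F_U`
  modulo degree `n+1`), §21.4.
* [Lazard1955] M. Lazard, Bull. SMF 83 (1955), §I Lemme 1, §II Prop. 2.
-/

noncomputable section

namespace Literature.RingTheory.FormalGroups

open MvPowerSeries

universe u v

variable {K : Type u} [CommRing K] {τ : Type v}

/-! ## §1 A strict series that moves only in degree `m` -/

section Setup

variable {ψ ψ' : PowerSeries K} {m : ℕ} {c : K}

/-- From `ψ ≡ ψ' + cX^m (mod deg m+1)` (coefficientwise) to the order statement for `ψ − ψ' − cX^m`.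
[cite: Lazard1955, §I Lemme 1] -/
theorem le_order_sub_sub_C_mul_X_pow (hlow : ∀ i < m, PowerSeries.coeff i ψ = PowerSeries.coeff i ψ')
    (hm : PowerSeries.coeff m ψ = PowerSeries.coeff m ψ' + c) :
    ((m + 1 : ℕ) : ℕ∞) ≤ MvPowerSeries.order (ψ - ψ' - PowerSeries.C c * PowerSeries.X ^ m : PowerSeries K) := by
  apply natCast_le_order_of_coeff_eq_zero
  intro i hi
  rw [map_sub, map_sub, PowerSeries.coeff_C_mul, PowerSeries.coeff_X_pow]
  rcases (Nat.lt_succ_iff.mp hi).lt_or_eq with h | h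
  · rw [hlow i h, if_neg h.ne, mul_zero, sub_self, sub_zero]
  · rw [h, hm, if_pos rfl, mul_one]; ring

/-- The perturbation substituted: `ψ(u) ≡ ψ'(u) + c·u^m (mod deg m+1)` for `u` without constant term.
[cite: Lazard1955, §I Lemme 1] -/
theorem le_order_psubst_sub_psubst_sub_mul_pow (hlow : ∀ i < m, PowerSeries.coeff i ψ = PowerSeries.coeff i ψ')
    (hm : PowerSeries.coeff m ψ = PowerSeries.coeff m ψ' + c) {u : MvPowerSeries τ K} (hu : constantCoeff u = 0) :
    ((m + 1 : ℕ) : ℕ∞) ≤ (PowerSeries.subst u ψ - PowerSeries.subst u ψ' - C c * u ^ m).order := by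
  have hus := PowerSeries.HasSubst.of_constantCoeff_zero hu
  have h := le_order_psubst_of_le (le_order_sub_sub_C_mul_X_pow hlow hm) hu
  have e : PowerSeries.subst u (ψ - ψ' - PowerSeries.C c * PowerSeries.X ^ m) =
      PowerSeries.subst u ψ - PowerSeries.subst u ψ' - C c * u ^ m := by
    rw [PowerSeries.subst_sub hus, PowerSeries.subst_sub hus, ← PowerSeries.smul_eq_C_mul, PowerSeries.subst_smul hus,
      PowerSeries.subst_pow hus, PowerSeries.subst_X hus, smul_eq_C_mul]
  rwa [e] at h

end Setup

/-! ## §2 The law `f⁻¹(f(X) + f(Y))` under a degree-`m` perturbation of `f` -/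

section Law

variable {ψ ψ' : PowerSeries K} {m : ℕ} {c : K}

/-- **`F ≡ F' − c·B_m (mod deg m+1)`** when `ψ ≡ ψ' + cX^m (mod deg m+1)` (`m ≥ 2`, both strict), `ψ(F) = ψ(X₀) + ψ(X₁)`,
`ψ'(F') = ψ'(X₀) + ψ'(X₁)`, `F' ≡ X₀ + X₁ (mod deg 2)`; here `B_m = (X₀ + X₁)^m − X₀^m − X₁^m`.
[cite: Hazewinkel1978, §5.7] [cite: Lazard1955, §II Prop. 2] -/
theorem le_order_logLaw_sub_logLaw_add (hψ0 : PowerSeries.constantCoeff ψ = 0) (hψ1 : PowerSeries.coeff 1 ψ = 1)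
    (hm2 : 2 ≤ m) (hlow : ∀ i < m, PowerSeries.coeff i ψ = PowerSeries.coeff i ψ')
    (hm : PowerSeries.coeff m ψ = PowerSeries.coeff m ψ' + c)
    {F F' : MvPowerSeries (Fin 2) K} (hF0 : constantCoeff F = 0) (hF'0 : constantCoeff F' = 0)
    (hF'1 : ((2 : ℕ) : ℕ∞) ≤ (F' - (X 0 + X 1)).order)
    (hF : PowerSeries.subst F ψ = PowerSeries.subst (X 0 : MvPowerSeries (Fin 2) K) ψ + PowerSeries.subst (X 1) ψ)
    (hF' : PowerSeries.subst F' ψ' = PowerSeries.subst (X 0 : MvPowerSeries (Fin 2) K) ψ' + PowerSeries.subst (X 1) ψ') :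
    ((m + 1 : ℕ) : ℕ∞) ≤ (F - (F' - C c * ((X 0 + X 1) ^ m - X 0 ^ m - X 1 ^ m))).order := by
  set B : MvPowerSeries (Fin 2) K := (X 0 + X 1) ^ m - X 0 ^ m - X 1 ^ m with hB
  have hm1 : 1 ≤ m := by omega
  -- `B_m` is homogeneous of degree `m`
  have hBord : (m : ℕ∞) ≤ B.order := by
    have hX0 : constantCoeff (X 0 : MvPowerSeries (Fin 2) K) = 0 := constantCoeff_X 0
    have hX1 : constantCoeff (X 1 : MvPowerSeries (Fin 2) K) = 0 := constantCoeff_X 1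
    have h1 : (m : ℕ∞) ≤ ((X 0 + X 1 : MvPowerSeries (Fin 2) K) ^ m).order :=
      le_order_pow_of_constantCoeff_eq_zero m (by rw [map_add, hX0, hX1, add_zero])
    have h2 : (m : ℕ∞) ≤ ((X 0 : MvPowerSeries (Fin 2) K) ^ m).order := le_order_pow_of_constantCoeff_eq_zero m hX0
    have h3 : (m : ℕ∞) ≤ ((X 1 : MvPowerSeries (Fin 2) K) ^ m).order := le_order_pow_of_constantCoeff_eq_zero m hX1
    exact natCast_le_order_sub (natCast_le_order_sub h1 h2) h3
  have hB0 : constantCoeff B = 0 := by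
    have := natCast_le_order_iff.mp hBord 0 (by simp; omega)
    rwa [coeff_zero_eq_constantCoeff] at this
  have hu0 : constantCoeff (F' - C c * B) = 0 := by rw [map_sub, map_mul, hF'0, hB0, mul_zero, sub_zero]
  -- `ψ` is injective modulo degrees
  apply le_order_sub_of_log_subst ψ hψ1 hψ0 hF0 hu0
  -- (1) `ψ(F' − cB) ≡ ψ(F') − cB`
  have h1 : ((m + 1 : ℕ) : ℕ∞) ≤ (PowerSeries.subst (F' - C c * B) ψ - PowerSeries.subst F' ψ - (F' - C c * B - F')).order :=
    le_order_psubst_sub_psubst_sub hψ0 hψ1 hm1 hu0 hF'0 (by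
      rw [show F' - C c * B - F' = -(C c * B) by ring, order_neg]
      exact natCast_le_order_mul_left _ hBord)
  -- (2) `ψ(F') ≡ ψ'(F') + c F'^m`
  have h2 := le_order_psubst_sub_psubst_sub_mul_pow hlow hm hF'0 (τ := Fin 2)
  -- (3) `F'^m ≡ (X₀ + X₁)^m`
  have h3 : ((m + 1 : ℕ) : ℕ∞) ≤ (F' ^ m - (X 0 + X 1 : MvPowerSeries (Fin 2) K) ^ m).order := by
    have := le_order_pow_sub_pow hF'0 (by rw [map_add, constantCoeff_X, constantCoeff_X, add_zero]) hF'1 m hm1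
    rw [show 2 + m - 1 = m + 1 by omega] at this
    exact this
  -- (4) `ψ(X_j) ≡ ψ'(X_j) + c X_j^m`
  have h4 : ∀ j : Fin 2, ((m + 1 : ℕ) : ℕ∞) ≤ (PowerSeries.subst (X j : MvPowerSeries (Fin 2) K) ψ -
      PowerSeries.subst (X j) ψ' - C c * X j ^ m).order := fun j =>
    le_order_psubst_sub_psubst_sub_mul_pow hlow hm (constantCoeff_X j)
  -- assemble
  have e : PowerSeries.subst F ψ - PowerSeries.subst (F' - C c * B) ψ =
      (PowerSeries.subst (X 0 : MvPowerSeries (Fin 2) K) ψ - PowerSeries.subst (X 0) ψ' - C c * X 0 ^ m) +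
      (PowerSeries.subst (X 1 : MvPowerSeries (Fin 2) K) ψ - PowerSeries.subst (X 1) ψ' - C c * X 1 ^ m) -
      (PowerSeries.subst (F' - C c * B) ψ - PowerSeries.subst F' ψ - (F' - C c * B - F')) -
      (PowerSeries.subst F' ψ - PowerSeries.subst F' ψ' - C c * F' ^ m) -
      C c * (F' ^ m - (X 0 + X 1) ^ m) := by
    rw [hF, hF', hB]; ring
  rw [e]
  refine natCast_le_order_sub (natCast_le_order_sub (natCast_le_order_sub (natCast_le_order_add (h4 0) (h4 1)) h1) h2)
    (natCast_le_order_mul_left _ h3)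

end Law

/-! ## §3 The `[a]`-series `f⁻¹(a·f(X))` under a degree-`m` perturbation of `f` -/

section Act

variable {ψ ψ' : PowerSeries K} {m : ℕ} {c : K}

/-- **`h ≡ h' + c(a − a^m)X^m (mod deg m+1)`** when `ψ ≡ ψ' + cX^m (mod deg m+1)` (`m ≥ 2`, both strict), `ψ(h) = a·ψ`,
`ψ'(h') = a·ψ'`, and `h' ≡ aX (mod deg 2)` (no constant term, linear coefficient `a`).
[cite: Hazewinkel1978, §21.4] [cite: Lazard1955, §I Lemme 1] -/
theorem le_order_logAct_sub_logAct_sub (hψ0 : PowerSeries.constantCoeff ψ = 0) (hψ1 : PowerSeries.coeff 1 ψ = 1)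
    (hm2 : 2 ≤ m) (hlow : ∀ i < m, PowerSeries.coeff i ψ = PowerSeries.coeff i ψ')
    (hm : PowerSeries.coeff m ψ = PowerSeries.coeff m ψ' + c) (a : K)
    {h h' : PowerSeries K} (hh0 : PowerSeries.constantCoeff h = 0) (hh'0 : PowerSeries.constantCoeff h' = 0)
    (hh'1 : PowerSeries.coeff 1 h' = a)
    (hh : PowerSeries.subst h ψ = a • ψ) (hh' : PowerSeries.subst h' ψ' = a • ψ') :
    ((m + 1 : ℕ) : ℕ∞) ≤ MvPowerSeries.order
      (h - (h' + PowerSeries.C (c * (a - a ^ m)) * PowerSeries.X ^ m) : PowerSeries K) := by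
  have hm1 : 1 ≤ m := by omega
  set E : PowerSeries K := PowerSeries.C (c * (a - a ^ m)) * PowerSeries.X ^ m with hE
  have hEord : (m : ℕ∞) ≤ MvPowerSeries.order E := by
    apply natCast_le_order_of_coeff_eq_zero
    intro i hi
    rw [hE, PowerSeries.coeff_C_mul, PowerSeries.coeff_X_pow, if_neg hi.ne, mul_zero]
  have hE0 : PowerSeries.constantCoeff E = 0 := by
    rw [hE, map_mul, map_pow, PowerSeries.constantCoeff_X, zero_pow (by omega), mul_zero]
  have hu0 : PowerSeries.constantCoeff (h' + E) = 0 := by rw [map_add, hh'0, hE0, add_zero]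
  -- `ψ` is injective modulo degrees (in `PowerSeries K = MvPowerSeries Unit K`)
  apply le_order_sub_of_log_subst (τ := Unit) ψ hψ1 hψ0 hh0 hu0
  -- (1) `ψ(h' + E) ≡ ψ(h') + E`
  have h1 : ((m + 1 : ℕ) : ℕ∞) ≤ MvPowerSeries.order
      (PowerSeries.subst (h' + E) ψ - PowerSeries.subst h' ψ - (h' + E - h') : PowerSeries K) :=
    le_order_psubst_sub_psubst_sub (τ := Unit) hψ0 hψ1 hm1 hu0 hh'0 (by
      rw [show (h' + E - h' : PowerSeries K) = E by ring]; exact hEord)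
  -- (2) `ψ(h') ≡ ψ'(h') + c h'^m`
  have h2 := le_order_psubst_sub_psubst_sub_mul_pow (τ := Unit) hlow hm (u := h') hh'0
  -- (3) `h'^m ≡ a^m X^m`
  have h3 : ((m + 1 : ℕ) : ℕ∞) ≤ MvPowerSeries.order (h' ^ m - (PowerSeries.C a * PowerSeries.X) ^ m : PowerSeries K) := by
    have hlin : ((2 : ℕ) : ℕ∞) ≤ MvPowerSeries.order (h' - PowerSeries.C a * PowerSeries.X : PowerSeries K) := by
      apply natCast_le_order_of_coeff_eq_zero
      intro i hi
      have hi' : i = 0 ∨ i = 1 := by omega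
      rcases hi' with rfl | rfl
      · rw [map_sub, PowerSeries.coeff_zero_eq_constantCoeff_apply, hh'0, PowerSeries.coeff_C_mul,
          PowerSeries.coeff_zero_eq_constantCoeff_apply, PowerSeries.constantCoeff_X, mul_zero, sub_zero]
      · rw [map_sub, hh'1, PowerSeries.coeff_C_mul, PowerSeries.coeff_one_X, mul_one, sub_self]
    have hCX : MvPowerSeries.constantCoeff (PowerSeries.C a * PowerSeries.X : PowerSeries K) = 0 := by
      show PowerSeries.constantCoeff (PowerSeries.C a * PowerSeries.X) = 0
      rw [map_mul, PowerSeries.constantCoeff_X, mul_zero]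
    have := le_order_pow_sub_pow (τ := Unit) (x := h') (x' := PowerSeries.C a * PowerSeries.X) hh'0 hCX hlin m hm1
    rw [show 2 + m - 1 = m + 1 by omega] at this
    exact this
  -- (4) `a ψ ≡ a ψ' + a c X^m`
  have h4 : ((m + 1 : ℕ) : ℕ∞) ≤ MvPowerSeries.order
      (a • ψ - a • ψ' - PowerSeries.C (a * c) * PowerSeries.X ^ m : PowerSeries K) := by
    have := le_order_sub_sub_C_mul_X_pow hlow hm
    have e : (a • ψ - a • ψ' - PowerSeries.C (a * c) * PowerSeries.X ^ m : PowerSeries K) =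
        PowerSeries.C a * (ψ - ψ' - PowerSeries.C c * PowerSeries.X ^ m) := by
      rw [PowerSeries.smul_eq_C_mul, PowerSeries.smul_eq_C_mul, map_mul]; ring
    rw [e]
    exact natCast_le_order_mul_left _ this
  -- assemble: `ψ(h) − ψ(h'+E) = (aψ − aψ' − acX^m) − (1) − (2) − c(h'^m − a^mX^m)` as series
  have e : (PowerSeries.subst h ψ - PowerSeries.subst (h' + E) ψ : PowerSeries K) =
      (a • ψ - a • ψ' - PowerSeries.C (a * c) * PowerSeries.X ^ m) -
      (PowerSeries.subst (h' + E) ψ - PowerSeries.subst h' ψ - (h' + E - h')) -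
      (PowerSeries.subst h' ψ - PowerSeries.subst h' ψ' - C c * h' ^ m) -
      PowerSeries.C c * (h' ^ m - (PowerSeries.C a * PowerSeries.X) ^ m) := by
    rw [hh, hh', hE]
    change _ = _ - _ - (_ - _ - PowerSeries.C c * h' ^ m) - _
    simp only [map_mul, map_sub, map_pow, PowerSeries.smul_eq_C_mul]
    ring
  rw [e]
  refine natCast_le_order_sub (natCast_le_order_sub (natCast_le_order_sub h4 h1) h2) ?_
  exact natCast_le_order_mul_left _ h3

end Act

end Literature.RingTheory.FormalGroups
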